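import Summits.ValiantsHypothesis.ValiantsHypothesis.Theorems.NcRotParseTreePermanent
import HarnessLib

/-!
# Skew circuits inside comb-typed rotation-UPT normal form, 1/2: the translation and its typing

Helper file of the KERNEL ARROW `SKEW ⊆ rot-NF(comb)` (restricted-models ladder of
`CommutativityDial`; item `PerNotNcVP` untouched). MODEL: rotUPT = rotation-UPT NORMAL FORM:
circuits typed by a shape T in which every product gate multiplies an operand typed by its left
child and one typed by its right child IN EITHER ORDER (GateRot = LLS18 Prop 7 typing + the
rotated product); the conversion of an arbitrary rotUPT circuit (LLS18 §4: all parse trees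
rotations of one tree) to this normal form (gate duplication per node, poly blow-up) is NOT
formalised. THIS FILE: the homogenising translation `skewHom d P` (HWY Lemma 3.3 for fan-in-two
SKEW circuits): gate `j` becomes the BLOCK of its degree slots `k ≤ d` (degree `0` enters only as
the sum weights `κ_j`); a skew product is re-expressed slot by slot: `g_j^{(k-1)} · x` is a
product at the comb node `0^{d-k}`, `x · g_j^{(k-1)}` the ROTATED product there. Proved: every
gate of `skewHom d P` is rot-typed by the LEFT COMB with `d` leaves (typed, if `P` has no rotated
product), output typed at the root, size `(d+1)(size+1)`, blocks read only earlier blocks.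
Semantics and the arrow: part 2/2. Says nothing about untyped circuits; NOT a new lower bound.
[cite: HrubesWigdersonYehudayoff2010, Lemma 3.3] [cite: LagardeLimayeSrinivasan2018, §3 Prop 7,
§4] [cite: LimayeMalodSrinivasan2016, §7]
-/

noncomputable section

namespace Summit.ValiantsHypothesis.ValiantsHypothesis.Theorems.NcSkewCombTyped

set_option linter.dupNamespace false
open Literature.Computability.AlgebraicComplexity
  Literature.Computability.AlgebraicComplexity.ArithCircuit
  Summit.ValiantsHypothesis.ValiantsHypothesis.Theorems.NcUniqueParseTree
  Summit.ValiantsHypothesis.ValiantsHypothesis.Theorems.NcRotParseTree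

universe u v

/-! ## §1 Left combs -/

/-- The LEFT COMB with `d` leaves (`d ≥ 1`; `comb 0 := leaf` is junk): the parse-tree shape of
a skew product chain. [cite: LagardeLimayeSrinivasan2018, §1] -/
def comb : ℕ → Shape
  | 0 => .leaf
  | 1 => .leaf
  | n + 2 => .node (comb (n + 1)) .leaf

/-- [cite: LagardeLimayeSrinivasan2018, §1] -/
theorem size_comb {d : ℕ} (hd : 1 ≤ d) : (comb d).size = d := by
  induction d with
  | zero => omega
  | succ n ih =>
    cases n with
    | zero => rfl
    | succ m => show (comb (m + 1)).size + 1 = m + 1 + 1; rw [ih (by omega)]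

/-- The comb below the node `0^j`. [cite: LagardeLimayeSrinivasan2018, §1] -/
theorem comb_sub {d j : ℕ} (hj : j < d) :
    (comb d).sub (List.replicate j false) = some (comb (d - j)) := by
  induction j generalizing d with
  | zero => rw [List.replicate_zero, Shape.sub_nil, Nat.sub_zero]
  | succ j ih =>
    obtain ⟨m, rfl⟩ : ∃ m, d = m + 2 := ⟨d - 2, by omega⟩
    rw [List.replicate_succ, show m + 2 - (j + 1) = m + 1 - j by omega, ← ih (by omega)]
    rfl

/-- [cite: LagardeLimayeSrinivasan2018, §1] -/
theorem comb_sub_node {d j : ℕ} (hj : j + 2 ≤ d) :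
    (comb d).sub (List.replicate j false) = some (.node (comb (d - j - 1)) .leaf) := by
  obtain ⟨m, hm⟩ : ∃ m, d - j = m + 2 := ⟨d - j - 2, by omega⟩
  rw [comb_sub (by omega), show d - j - 1 = m + 1 by omega, hm]
  rfl

/-- The leftmost leaf `0^{d-1}`. [cite: LagardeLimayeSrinivasan2018, §1] -/
theorem comb_sub_leaf {d : ℕ} (hd : 1 ≤ d) :
    (comb d).sub (List.replicate (d - 1) false) = some .leaf := by
  rw [comb_sub (by omega), show d - (d - 1) = 1 by omega]
  rfl

/-- The right leaf `0^j 1`. [cite: LagardeLimayeSrinivasan2018, §1] -/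
theorem comb_sub_true {d j : ℕ} (hj : j + 2 ≤ d) :
    (comb d).sub (List.replicate j false ++ [true]) = some .leaf := by
  rw [Shape.sub_sub (comb_sub_node hj)]
  rfl

/-! ## §2 The homogenising translation into comb-typed normal form -/

variable {R : Type u} [CommSemiring R] {σ : Type v}

/-- Position of the degree-`k` slot of gate `j`. [cite: HrubesWigdersonYehudayoff2010, Lemma 3.3] -/
def hix (d j k : ℕ) : ℕ := j * (d + 1) + k

/-- Types: the slot of degree `k` is typed by the comb node `0^{d-k}` (degree `0`: off the tree).
[cite: LagardeLimayeSrinivasan2018, §3 Prop 7] -/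
def hty (d : ℕ) (m : ℕ) : List Bool := List.replicate (d - m % (d + 1)) false

/-- Translation of a weighted operand of block `i` at degree `k`: an earlier gate `j < i` becomes
its degree-`k` slot, a letter survives in degree `1` only, scalars and non-earlier references
(junk `0`) are dropped. [cite: HrubesWigdersonYehudayoff2010, Lemma 3.3] -/
def homOp (d i k : ℕ) : R × Operand R σ → Option (R × Operand R σ)
  | (c, .gate j) => if j < i then some (c, .gate (hix d j k)) else none
  | (c, .var x) => if k = 1 then some (c, .var x) else none
  | (_, .const _) => none

/-- Translation of a fan-in-two product `u · v` of block `i` at degree `k ≥ 1` (`κ j` = the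
constant coefficient of gate `j`): `g_j · x ↦ g_j^{(k-1)} · x` (`mul`), `x · g_j ↦ x · g_j^{(k-1)}`
(`rot`) in degree `k ≥ 2`, `↦ κ_j • x` in degree `1`; scalar factors become weighted copies
(through `homOp`); `x · y` lives in degree `2`. [cite: HrubesWigdersonYehudayoff2010, Lemma 3.3] -/
def homMul (d : ℕ) (κ : ℕ → R) (i k : ℕ) : Operand R σ → Operand R σ → Gate R σ
  | .gate j, .var x =>
      if j < i then (if 2 ≤ k then .prod [.gate (hix d j (k - 1)), .var x]
        else .sum ([(κ j, Operand.var x)].filterMap (homOp d i k))) else .sum []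
  | .var x, .gate j =>
      if j < i then (if 2 ≤ k then .prod [.var x, .gate (hix d j (k - 1))]
        else .sum ([(κ j, Operand.var x)].filterMap (homOp d i k))) else .sum []
  | .gate j, .const c => .sum ([(c, Operand.gate j)].filterMap (homOp d i k))
  | .const c, .gate j => .sum ([(c, Operand.gate j)].filterMap (homOp d i k))
  | .var x, .var y => if k = 2 then .prod [.var x, .var y] else .sum []
  | .var x, .const c => .sum ([(c, Operand.var x)].filterMap (homOp d i k))
  | .const c, .var x => .sum ([(c, Operand.var x)].filterMap (homOp d i k))
  | .const _, .const _ => .sum []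
  | .gate _, .gate _ => .sum []

/-- Translation of a gate of block `i` at degree `k ≥ 1`. [cite: HrubesWigdersonYehudayoff2010] -/
def homSlot (d : ℕ) (κ : ℕ → R) (i k : ℕ) : Gate R σ → Gate R σ
  | .sum args => .sum (args.filterMap (homOp d i k))
  | .prod [u] => .sum ([((1 : R), u)].filterMap (homOp d i k))
  | .prod [u, v] => homMul d κ i k u v
  | .prod _ => .sum []

/-- The block of gate `i`: its `d + 1` slots (slot `0` is the empty sum).
[cite: HrubesWigdersonYehudayoff2010, Lemma 3.3] -/
def homBlock (d : ℕ) (κ : ℕ → R) (i : ℕ) (g : Gate R σ) : List (Gate R σ) :=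
  (List.range (d + 1)).map fun k => if k = 0 then Gate.sum [] else homSlot d κ i k g

/-- The blocks of a gate list, numbered from `i`. [cite: HrubesWigdersonYehudayoff2010] -/
def homBlocks (d : ℕ) (κ : ℕ → R) : ℕ → List (Gate R σ) → List (Gate R σ)
  | _, [] => []
  | i, g :: gs => homBlock d κ i g ++ homBlocks d κ (i + 1) gs

/-- The constant coefficients of the gate values of `gs`. [cite: HrubesWigdersonYehudayoff2010] -/
def kappa (gs : List (Gate R σ)) (j : ℕ) : R :=
  FreeAlgebra.algebraMapInv ((ncGateValues gs).getD j 0)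

/-- THE HOMOGENISING TRANSLATION of `P` at degree `d`: the blocks of `P.gates ++ [copy of the
output]`, output = the degree-`d` slot of that copy. [cite: HrubesWigdersonYehudayoff2010] -/
def skewHom (d : ℕ) (P : ArithCircuit R σ) : ArithCircuit R σ where
  gates := homBlocks d (kappa (P.gates ++ [Gate.prod [P.output]])) 0
    (P.gates ++ [Gate.prod [P.output]])
  output := .gate (hix d P.gates.length d)

/-! ## §3 Typing and reference discipline of the translation -/

/-- [cite: LagardeLimayeSrinivasan2018, §3 Prop 7] -/
theorem hty_hix {d j k : ℕ} (hk : k ≤ d) : hty d (hix d j k) = List.replicate (d - k) false := by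
  unfold hty hix
  rw [Nat.mul_add_mod_of_lt (show k < d + 1 by omega)]

omit [CommSemiring R] in
/-- Helper: what `homOp` outputs. [cite: HrubesWigdersonYehudayoff2010, Lemma 3.3] -/
theorem homOp_some {d i k : ℕ} {a b : R × Operand R σ} (h : homOp d i k a = some b) :
    (∃ j, j < i ∧ b.2 = Operand.gate (hix d j k)) ∨ (∃ x, k = 1 ∧ b.2 = Operand.var x) := by
  obtain ⟨c, u⟩ := a
  cases u with
  | gate j =>
    by_cases hj : j < i
    · simp only [homOp, if_pos hj, Option.some.injEq] at h; exact Or.inl ⟨j, hj, by subst h; rfl⟩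
    · simp [homOp, if_neg hj] at h
  | var x =>
    by_cases h1 : k = 1
    · simp only [homOp, if_pos h1, Option.some.injEq] at h; exact Or.inr ⟨x, h1, by subst h; rfl⟩
    · simp [homOp, if_neg h1] at h
  | const c' => simp [homOp] at h

/-- Translated operands are typed at their slot. [cite: LagardeLimayeSrinivasan2018, §3 Prop 7] -/
theorem homOp_typed {d i k : ℕ} (hk1 : 1 ≤ k) (hk : k ≤ d) {a b : R × Operand R σ}
    (h : homOp d i k a = some b) : OpTyped (comb d) (hty d) (List.replicate (d - k) false) b.2 := by
  rcases homOp_some h with ⟨j, -, hb⟩ | ⟨x, h1, hb⟩ <;> rw [hb]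
  · exact OpTyped.gate (hty_hix hk)
  · rw [h1]; exact OpTyped.var (comb_sub_leaf (hk1.trans hk))

omit [CommSemiring R] in
/-- Helper: the SHAPES of `homMul`'s output — a `homOp`-filtered sum, `g_j^{(k-1)} · x`, the
rotated `x · g_j^{(k-1)}`, or `x · y`. [cite: HrubesWigdersonYehudayoff2010, Lemma 3.3] -/
theorem homMul_shape (d : ℕ) (κ : ℕ → R) (i k : ℕ) (u v : Operand R σ) :
    (∃ l : List (R × Operand R σ), homMul d κ i k u v = .sum (l.filterMap (homOp d i k))) ∨
    (∃ (j : ℕ) (x : σ), j < i ∧ 2 ≤ k ∧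
      (homMul d κ i k u v = .prod [.gate (hix d j (k - 1)), .var x] ∨
        (Gate.prod [u, v] = .prod [.var x, .gate j] ∧
          homMul d κ i k u v = .prod [.var x, .gate (hix d j (k - 1))]))) ∨
    (∃ x y : σ, k = 2 ∧ homMul d κ i k u v = .prod [.var x, .var y]) := by
  have h0 : ∃ l : List (R × Operand R σ),
      (Gate.sum [] : Gate R σ) = .sum (l.filterMap (homOp d i k)) := ⟨[], rfl⟩
  cases u <;> cases v <;> simp only [homMul] <;> (try split_ifs) <;> first
    | exact Or.inl h0
    | exact Or.inl ⟨_, rfl⟩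
    | exact Or.inr (Or.inr ⟨_, _, by assumption, rfl⟩)
    | exact Or.inr (Or.inl ⟨_, _, by assumption, by assumption, Or.inl rfl⟩)
    | exact Or.inr (Or.inl ⟨_, _, by assumption, by assumption, Or.inr ⟨rfl, rfl⟩⟩)

/-- Helper: `homOp`-filtered sums are typed. [cite: LagardeLimayeSrinivasan2018, §3 Prop 7] -/
theorem sum_filterMap_gateTyped {d : ℕ} (i : ℕ) {k : ℕ} (hk1 : 1 ≤ k) (hk : k ≤ d)
    (l : List (R × Operand R σ)) :
    GateTyped (comb d) (hty d) (List.replicate (d - k) false) (.sum (l.filterMap (homOp d i k))) :=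
  GateTyped.sum fun _ hb => by
    obtain ⟨a, -, hab⟩ := List.mem_filterMap.1 hb
    exact homOp_typed hk1 hk hab

/-- Helper: a translated product is typed, unless it is the ROTATED `x · g_j^{(k-1)}` (which is
rot-typed). [cite: LagardeLimayeSrinivasan2018, §3 Prop 7, §4] -/
theorem homMul_typedOrRot {d : ℕ} (κ : ℕ → R) (i : ℕ) {k : ℕ} (hk1 : 1 ≤ k) (hk : k ≤ d)
    (u v : Operand R σ) : GateTyped (comb d) (hty d) (List.replicate (d - k) false)
      (homMul d κ i k u v) ∨ ∃ (x : σ) (j : ℕ), Gate.prod [u, v] = .prod [.var x, .gate j] ∧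
        GateRot (comb d) (hty d) (List.replicate (d - k) false) (homMul d κ i k u v) := by
  have ht := fun h : 2 ≤ k => comb_sub_true (d := d) (j := d - k) (by omega)
  have hf (j : ℕ) (h : 2 ≤ k) :
      hty d (hix d j (k - 1)) = List.replicate (d - k) false ++ [false] := by
    rw [hty_hix (by omega), ← List.replicate_succ', show d - k + 1 = d - (k - 1) by omega]
  rcases homMul_shape d κ i k u v with ⟨l, hl⟩ | ⟨j, x, _, h2, hl | ⟨hx, hl⟩⟩ | ⟨_, _, h2, hl⟩ <;>
    rw [hl]
  · exact .inl (sum_filterMap_gateTyped i hk1 hk l)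
  · exact .inl (.mul (comb_sub_node (by omega)) (.gate (hf j h2)) (.var (ht h2)))
  · exact .inr ⟨x, j, hx, .rot (comb_sub_node (by omega)) (.var (ht h2)) (.gate (hf j h2))⟩
  · refine .inl (.mul (comb_sub_node (by omega)) (.var ?_) (.var (ht (by omega))))
    rw [← List.replicate_succ', show d - k + 1 = d - 1 by omega]; exact comb_sub_leaf (by omega)

/-- Translated products are rot-typed at their slot. [cite: LagardeLimayeSrinivasan2018, §4] -/
theorem homMul_rot {d : ℕ} (κ : ℕ → R) (i : ℕ) {k : ℕ} (hk1 : 1 ≤ k) (hk : k ≤ d)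
    (u v : Operand R σ) :
    GateRot (comb d) (hty d) (List.replicate (d - k) false) (homMul d κ i k u v) :=
  (homMul_typedOrRot κ i hk1 hk u v).elim GateRot.of_gateTyped fun ⟨_, _, _, h⟩ => h

/-- Typing of the slots, rotated products `x · g_j ↦ x · g_j^{(k-1)}` included.
[cite: LagardeLimayeSrinivasan2018, §4] -/
theorem homSlot_rot {d : ℕ} (κ : ℕ → R) (i : ℕ) {k : ℕ} (hk1 : 1 ≤ k) (hk : k ≤ d)
    (g : Gate R σ) :
    GateRot (comb d) (hty d) (List.replicate (d - k) false) (homSlot d κ i k g) := by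
  have hop := fun l : List (R × Operand R σ) =>
    GateRot.of_gateTyped (sum_filterMap_gateTyped i hk1 hk l)
  rcases g with args | (_ | ⟨u, _ | ⟨v, _ | _⟩⟩)
  exacts [hop args, hop [], hop _, homMul_rot κ i hk1 hk u v, hop []]

/-- Typing of the slots WITHOUT rotated products `x · g_j` (UPT normal form).
[cite: LagardeLimayeSrinivasan2018, §3 Prop 7] -/
theorem homSlot_gateTyped {d : ℕ} (κ : ℕ → R) (i : ℕ) {k : ℕ} (hk1 : 1 ≤ k) (hk : k ≤ d)
    (g : Gate R σ) (hL : ∀ (x : σ) (j : ℕ), g ≠ Gate.prod [Operand.var x, Operand.gate j]) :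
    GateTyped (comb d) (hty d) (List.replicate (d - k) false) (homSlot d κ i k g) := by
  have hop := sum_filterMap_gateTyped (R := R) (σ := σ) i hk1 hk
  rcases g with args | (_ | ⟨u, _ | ⟨v, _ | _⟩⟩)
  · exact hop args
  · exact hop []
  · exact hop _
  · exact (homMul_typedOrRot κ i hk1 hk u v).elim id fun ⟨x, j, hx, _⟩ => absurd hx (hL x j)
  · exact hop []

/-- [cite: HrubesWigdersonYehudayoff2010, Lemma 3.3] -/
theorem length_homBlocks (d : ℕ) (κ : ℕ → R) (gs : List (Gate R σ)) (i : ℕ) :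
    (homBlocks d κ i gs).length = (d + 1) * gs.length := by
  induction gs generalizing i with
  | nil => simp [homBlocks]
  | cons g gs ih =>
    simp only [homBlocks, List.length_append, ih, List.length_cons, homBlock, List.length_map,
      List.length_range]
    ring

/-- [cite: HrubesWigdersonYehudayoff2010, Lemma 3.3] -/
theorem homBlocks_append (d : ℕ) (κ : ℕ → R) (gs : List (Gate R σ)) (g : Gate R σ) (i : ℕ) :
    homBlocks d κ i (gs ++ [g]) = homBlocks d κ i gs ++ homBlock d κ (i + gs.length) g := by
  induction gs generalizing i with
  | nil => simp [homBlocks]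
  | cons g' gs ih =>
    simp only [List.cons_append, homBlocks]
    rw [ih, List.append_assoc, List.length_cons,
      show i + 1 + gs.length = i + (gs.length + 1) by omega]

/-- Helper: the slots of one block under a typing `Ty`. [cite: LagardeLimayeSrinivasan2018] -/
theorem homBlock_slots {d : ℕ} (κ : ℕ → R) (i : ℕ) (g : Gate R σ)
    {Ty : List Bool → Gate R σ → Prop} (h0 : ∀ π, Ty π (.sum []))
    (hs : ∀ k, 1 ≤ k → k ≤ d → Ty (List.replicate (d - k) false) (homSlot d κ i k g)) :
    ∀ m (hm : m < (homBlock d κ i g).length), Ty (hty d m) (homBlock d κ i g)[m] := by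
  intro m hm
  have hm' : m < d + 1 := by simpa [homBlock] using hm
  have hget : (homBlock d κ i g)[m] = if m = 0 then Gate.sum [] else homSlot d κ i m g := by
    simp [homBlock]
  unfold hty
  rw [hget, Nat.mod_eq_of_lt hm']
  split_ifs with h
  exacts [h0 _, hs m (by omega) (by omega)]

/-- Helper: the slots of all blocks under a typing `Ty`. [cite: LagardeLimayeSrinivasan2018] -/
theorem homBlocks_slots {d : ℕ} (κ : ℕ → R) {Ty : List Bool → Gate R σ → Prop}
    {Q : Gate R σ → Prop} (h0 : ∀ π, Ty π (.sum [])) (hs : ∀ i g k, Q g → 1 ≤ k → k ≤ d →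
      Ty (List.replicate (d - k) false) (homSlot d κ i k g)) : ∀ (gs : List (Gate R σ)) (i : ℕ),
    (∀ g ∈ gs, Q g) → ∀ m (hm : m < (homBlocks d κ i gs).length),
      Ty (hty d m) (homBlocks d κ i gs)[m]
  | [], _, _, m, hm => absurd hm (by simp [homBlocks])
  | g :: gs, i, hQ, m, hm => by
    have hL : (homBlock d κ i g).length = d + 1 := by simp [homBlock]
    change Ty (hty d m) ((homBlock d κ i g ++ homBlocks d κ (i + 1) gs)[m]'hm)
    by_cases hlt : m < d + 1
    · rw [List.getElem_append_left (by omega)]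
      exact homBlock_slots κ i g h0 (fun k => hs i g k (hQ g (by simp))) m _
    · rw [List.getElem_append_right (by omega), show hty d m = hty d (m - (homBlock d κ i g).length)
        by unfold hty; rw [hL, Nat.mod_eq_sub_mod (by omega)]]
      exact homBlocks_slots κ h0 hs gs (i + 1) (fun g' hg' => hQ g' (by simp [hg'])) _ _

/-- Every slot of every block is rot-typed by the comb. [cite: LagardeLimayeSrinivasan2018, §4] -/
theorem homBlocks_typed (d : ℕ) (κ : ℕ → R) (gs : List (Gate R σ)) (i : ℕ) :
    ∀ m (hm : m < (homBlocks d κ i gs).length),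
      GateRot (comb d) (hty d) (hty d m) (homBlocks d κ i gs)[m] :=
  homBlocks_slots κ (Ty := GateRot (comb d) (hty d)) (Q := fun _ => True)
    (fun _ => GateRot.sum (by simp)) (fun i g k _ hk1 hk => homSlot_rot κ i hk1 hk g) gs i
    (fun _ _ => trivial)

/-- Without rotated products every slot is typed. [cite: LagardeLimayeSrinivasan2018, §3 Prop 7] -/
theorem homBlocks_gateTyped (d : ℕ) (κ : ℕ → R) (gs : List (Gate R σ)) (i : ℕ)
    (hL : ∀ g ∈ gs, ∀ (x : σ) (j : ℕ), g ≠ Gate.prod [Operand.var x, Operand.gate j]) :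
    ∀ m (hm : m < (homBlocks d κ i gs).length),
      GateTyped (comb d) (hty d) (hty d m) (homBlocks d κ i gs)[m] :=
  homBlocks_slots κ (Ty := GateTyped (comb d) (hty d))
    (Q := fun g => ∀ (x : σ) (j : ℕ), g ≠ Gate.prod [Operand.var x, Operand.gate j])
    (fun _ => GateTyped.sum (by simp)) (fun i g k hg hk1 hk => homSlot_gateTyped κ i hk1 hk g hg)
    gs i hL

/-- **Reference discipline**: block `i` only reads slots of EARLIER blocks.
[cite: HrubesWigdersonYehudayoff2010, Lemma 3.3] -/
theorem homBlock_refsBelow (d : ℕ) (κ : ℕ → R) (i : ℕ) (g : Gate R σ) :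
    ∀ b ∈ homBlock d κ i g, ∀ u ∈ b.args, u.RefsBelow (i * (d + 1)) := by
  have hv : ∀ x : σ, (Operand.var x : Operand R σ).RefsBelow (i * (d + 1)) := fun _ => trivial
  have hG : ∀ {j : ℕ} (k : ℕ), j < i → k ≤ d →
      (Operand.gate (hix d j k) : Operand R σ).RefsBelow (i * (d + 1)) :=
    fun {j} k hj hk => show j * (d + 1) + k < i * (d + 1) from
      (show j * (d + 1) + k < (j + 1) * (d + 1) by rw [add_one_mul]; omega).trans_le
        (Nat.mul_le_mul_right (d + 1) hj)
  have hsum : ∀ {k : ℕ} (l : List (R × Operand R σ)), k ≤ d →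
      ∀ u ∈ (Gate.sum (l.filterMap (homOp d i k))).args, u.RefsBelow (i * (d + 1)) := by
    intro k l hk u hu
    simp only [Gate.args, List.mem_map, List.mem_filterMap] at hu
    obtain ⟨b, ⟨a, -, h⟩, rfl⟩ := hu
    rcases homOp_some h with ⟨j, hj, hb⟩ | ⟨x, -, hb⟩ <;> rw [hb]
    exacts [hG k hj hk, hv x]
  intro b hb u hu
  simp only [homBlock, List.mem_map, List.mem_range] at hb
  obtain ⟨k, hk, rfl⟩ := hb
  split_ifs at hu with hk0
  · simp [Gate.args] at hu
  · have hkd : k ≤ d := by omega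
    rcases g with args | (_ | ⟨v, _ | ⟨w, _ | _⟩⟩)
    · exact hsum args hkd u hu
    · exact hsum [] hkd u hu
    · exact hsum _ hkd u hu
    · change u ∈ (homMul d κ i k v w).args at hu
      rcases homMul_shape d κ i k v w with ⟨l, hl⟩ | ⟨j, x, hj, _, hl | ⟨-, hl⟩⟩ | ⟨x, y, _, hl⟩ <;>
        rw [hl] at hu
      · exact hsum l hkd u hu
      all_goals simp only [Gate.args, List.mem_cons, List.not_mem_nil, or_false] at hu
      · rcases hu with rfl | rfl
        exacts [hG (k - 1) hj (by omega), hv x]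
      · rcases hu with rfl | rfl
        exacts [hv x, hG (k - 1) hj (by omega)]
      · rcases hu with rfl | rfl
        exacts [hv x, hv y]
    · exact hsum [] hkd u hu

/-- **Typing of the translation**: every gate of `skewHom d P` is rot-typed by the left comb
(MODEL: rotUPT = rotation-UPT NORMAL FORM, see the module docstring; says nothing about untyped
circuits). [cite: LagardeLimayeSrinivasan2018, §4] [cite: HrubesWigdersonYehudayoff2010] -/
theorem skewHom_typed (d : ℕ) (P : ArithCircuit R σ) :
    ∀ m (hm : m < (skewHom d P).gates.length),
      GateRot (comb d) (hty d) (hty d m) (skewHom d P).gates[m] :=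
  homBlocks_typed d (kappa (P.gates ++ [Gate.prod [P.output]]))
    (P.gates ++ [Gate.prod [P.output]]) 0

/-- Without rotated products `x · g_j` the translation is in UPT normal form.
[cite: LagardeLimayeSrinivasan2018, §3 Prop 7] -/
theorem skewHom_gateTyped (d : ℕ) (P : ArithCircuit R σ)
    (hL : ∀ g ∈ P.gates, ∀ (x : σ) (j : ℕ), g ≠ Gate.prod [Operand.var x, Operand.gate j]) :
    ∀ m (hm : m < (skewHom d P).gates.length),
      GateTyped (comb d) (hty d) (hty d m) (skewHom d P).gates[m] :=
  homBlocks_gateTyped d (kappa (P.gates ++ [Gate.prod [P.output]]))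
    (P.gates ++ [Gate.prod [P.output]]) 0 fun g hg x j => by
    rcases List.mem_append.1 hg with hg | hg
    · exact hL g hg x j
    · rw [List.mem_singleton.1 hg]; simp

/-- The output is typed at the root. [cite: LagardeLimayeSrinivasan2018, §3 Prop 7] -/
theorem skewHom_output (d : ℕ) (P : ArithCircuit R σ) :
    OpTyped (comb d) (hty d) [] (skewHom d P).output :=
  OpTyped.gate (j := hix d P.gates.length d)
    (by rw [hty_hix le_rfl, Nat.sub_self, List.replicate_zero])

/-- Size of the translation: `(d+1)(size+1)`. [cite: HrubesWigdersonYehudayoff2010, Lemma 3.3] -/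
theorem size_skewHom (d : ℕ) (P : ArithCircuit R σ) :
    (skewHom d P).size = (d + 1) * (P.size + 1) := by
  show (homBlocks d (kappa (P.gates ++ [Gate.prod [P.output]])) 0
    (P.gates ++ [Gate.prod [P.output]])).length = (d + 1) * (P.size + 1)
  rw [length_homBlocks, List.length_append, List.length_singleton]
  rfl

end Summit.ValiantsHypothesis.ValiantsHypothesis.Theorems.NcSkewCombTyped
end
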